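/-
Copyright (c) 2026 the pub-hodgecm-mathlib formalisation cell (harness21).  Prover seat hodgecm-mathlib-LH4-p04 (g2), req620 Track A «(D-RAM) FOUR-FRAME» squad
(MS ROAD A, STAGE B brick B3 «DUALISABLE STRATA TABLE» of LH4-p10 (g2) `SPEC-StageB.v1` §B — part 1: the dual-frame values and the HNF Gram matrix).  2026-09-04.
-/
import Summits.HodgeConjecture.HodgeConjecture.Theorems.F0P3cDyRamDiagonalTorusDefs              -- ★ DEFS LEAF p855572: `IsNormalisedLattice`
import Summits.HodgeConjecture.HodgeConjecture.Theorems.F0P3cDyRamDiagonalDualisableExponents    -- ★ (3c-i) p855394: `v_eq_rowSup_dualOne_of_rowSup_eq_one` (the axis exponents `|D_i|`)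
import Summits.HodgeConjecture.HodgeConjecture.Theorems.F0P3cDyRamDiagonalStableLatticeHNF       -- ★ p855280: `normalised_latt_hnf_iff`, `det_hnf`
import Literature.NumberTheory.Automorphic.UnitaryLatticeTreeTypeTwoGram                          -- ★ `vertexTriple_of_latt_eq` (Gram conditions hold in every basis)
import HarnessLib

/-!
# Crux `H413`, line LH4 «(D-RAM) FOUR-FRAME» road — unit U3_Laws (iii), MS ROAD A, STAGE B brick B3 (part 1): THE DUAL-FRAME VALUES `|D_i|` AND THE HNF GRAM MATRIX
# of a normalised HNF lattice `(1 0 0; x ϖ^b 0; y z ϖ^c)·𝒪³` that is self-dual for a diagonal form `diag(D)`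

Cell `hodgecm-mathlib` (D-0151), FLOOR 0, crux item H413 = `stmt-HodgeConjecture-24833`, route of record `HCCMUnconditional`; squad F0∕P3c∕LH4 (req618∕req620); registered stub served:
`F0P3cDyRamFourFrameU3.stub_U3_stableModelSum` (MS).  THEOREMS ONLY (no `def`, no instance, no notation, no `sorry`, default heartbeats); lane
`--supports stmt-HodgeConjecture-24833 --as helper` (count-neutral).  STAGE B (LH4-p10 (g2) `MEMO-stableLaw-finite.v2` §1∕§3, `SPEC-StageB.v1` §B): the strata table (part 2,
`F0P3cDyRamDiagonalDualisableStrata`) is a case analysis on the facts packaged here.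

THE MATHEMATICS (MEMO v2 §1, §3).  For `M = latt V`, `V = (1 0 0; x ϖ^b 0; y z ϖ^c)`, `x y z ∈ 𝒪`, NORMALISED (★ `normalised_latt_hnf_iff`), self-dual for `diag(D)` (`D_i ≠ 0`):
★ (3c-i) `v_eq_rowSup_dualOne_of_rowSup_eq_one` says `|D_i|` is the `i`-th row maximum of the dual frame `U_1 = ((σV)ᵀ)⁻¹`, i.e. (§3 `dualFrame_values`)
`|D₂| = exp c`, `|D₁| = max(exp b, |z|·exp(b+c))`, `|D₀| = max(1, |x|·exp b, |xz − yϖ^b|·exp(b+c))` — the AXIS EXPONENTS `a_i = −v(D_i)` of MEMO §1 ∕ ★ B2 p855755 —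
stated as «bound + attained» triples; and in the HNF basis the Gram matrix `G = (σV)ᵀ diag(D) V` is integral with `|det G| = 1` (★ `vertexTriple_of_latt_eq`), whose entries
`G₁₁ = σ(ϖ^b)D₁ϖ^b + σz·D₂·z`, `G₀₀ = D₀ + σx·D₁·x + σy·D₂·y` and determinant `σ(ϖ^bϖ^c)·D₀D₁D₂·ϖ^bϖ^c` (§2) are what the eliminations of MEMO (3.1) use (§3 `gram_values`).

WHAT IS PROVED.  §1 `sup'_univ_eq_of_forall_le_of_exists_eq`, `le_of_sup'_univ_eq`, `exists_eq_of_sup'_univ_eq` (sandwich bookkeeping for `Finset.univ.sup'` over `Fin n`);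
§2 `hnf_gram_apply_one_one`, `hnf_gram_apply_zero_zero`, `hnf_gram_det`; §3 `dualFrame_values`, `gram_values`.
HONEST LABEL.  Count-neutral (`--supports`); nothing printed is asserted; (MS) stays a PROVER TARGET (empirical census law — MEMO v2 is its paper proof); `HC_CM` is proved only
modulo the 7 printed citations (2 remaining named inputs: hLiu418 = `stmt-HodgeConjecture-24832`, h413 = `stmt-HodgeConjecture-24833`) until rung 0 closes.

## References
* [Jacobowitz1962] R. Jacobowitz, *Hermitian forms over local fields*, Amer. J. Math. 84 (1962), §4 (Gram matrices, dual bases), §7 (unimodular lattices).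
* [Kottwitz1986BaseChangeUnits] R. E. Kottwitz, *Base change for unit elements of Hecke algebras*, Compositio Math. 60 (1986), §1 pp. 240–241 (fixed-lattice counting by position).
* [Serre1980Trees] J.-P. Serre, *Trees*, Springer (1980), Ch. II §1.1 (lattices `g·𝒪^N`, Hermite normal forms, coordinate axes).
-/

set_option autoImplicit false

noncomputable section

namespace Summit.HodgeConjecture.HodgeConjecture.Cruxes.H413.F0P3cDyRamDiagonalHNFDualFrameValues

open Matrix
open Literature.NumberTheory.Automorphic Literature.NumberTheory.Automorphic.HermitianLattice
open Literature.NumberTheory.Automorphic.UnitaryLatticeTree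
open Summit.HodgeConjecture.HodgeConjecture.Cruxes.H413.F0P3cDyRamDiagonalTorusDefs
open Summit.HodgeConjecture.HodgeConjecture.Cruxes.H413.F0P3cDyRamDiagonalDualisableExponents
open Summit.HodgeConjecture.HodgeConjecture.Cruxes.H413.F0P3cDyRamDiagonalStableLatticeHNF
open scoped Valued WithZero Matrix MatrixGroups

/-! ## §1  Row maxima over `Fin 3` (sandwich lemmas for `Finset.sup'`) -/

/-- `sup' = a` from a uniform bound and one attaining index. [cite: Serre1980Trees, II §1.1] -/
theorem sup'_univ_eq_of_forall_le_of_exists_eq {α : Type*} [LinearOrder α] {n : ℕ} [NeZero n] (f : Fin n → α) (a : α)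
    (hle : ∀ j, f j ≤ a) (hex : ∃ j, f j = a) : Finset.univ.sup' Finset.univ_nonempty f = a := by
  refine le_antisymm (Finset.sup'_le _ _ fun j _ => hle j) ?_
  obtain ⟨j, hj⟩ := hex
  rw [← hj]
  exact Finset.le_sup' f (Finset.mem_univ j)

/-- Every value is bounded by `sup'`. [cite: Serre1980Trees, II §1.1] -/
theorem le_of_sup'_univ_eq {α : Type*} [LinearOrder α] {n : ℕ} [NeZero n] {f : Fin n → α} {a : α}
    (h : Finset.univ.sup' Finset.univ_nonempty f = a) (j : Fin n) : f j ≤ a :=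
  h ▸ Finset.le_sup' f (Finset.mem_univ j)

/-- `sup'` is attained. [cite: Serre1980Trees, II §1.1] -/
theorem exists_eq_of_sup'_univ_eq {α : Type*} [LinearOrder α] {n : ℕ} [NeZero n] {f : Fin n → α} {a : α}
    (h : Finset.univ.sup' Finset.univ_nonempty f = a) : ∃ j, f j = a := by
  obtain ⟨j, -, hj⟩ := Finset.exists_mem_eq_sup' Finset.univ_nonempty f
  exact ⟨j, hj.symm.trans h⟩

variable {K : Type*} [Field K] [Valued K ℤᵐ⁰]

/-! ## §2  The Gram matrix of the HNF basis for a diagonal form: the two diagonal entries and the determinant we use -/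

omit [Valued K ℤᵐ⁰] in
/-- Entry `(1,1)` of `(σV)ᵀ·diag(D)·V` for the HNF model `V = [[1,0,0],[x,ϖ^b,0],[y,z,ϖ^c]]`: `σ(ϖ^b)·D₁·ϖ^b + σz·D₂·z`. [cite: Jacobowitz1962, §4] -/
theorem hnf_gram_apply_one_one (σ : K →+* K) (D : Fin 3 → K) (x y z p r : K) :
    (((Matrix.of ![![1, 0, 0], ![x, p, 0], ![y, z, r]]).map σ)ᵀ * Matrix.diagonal D * Matrix.of ![![1, 0, 0], ![x, p, 0], ![y, z, r]]) 1 1 =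
      σ p * D 1 * p + σ z * D 2 * z := by
  simp [Matrix.mul_apply, Fin.sum_univ_three]

omit [Valued K ℤᵐ⁰] in
/-- Entry `(0,0)` of `(σV)ᵀ·diag(D)·V`: `D₀ + σx·D₁·x + σy·D₂·y`. [cite: Jacobowitz1962, §4] -/
theorem hnf_gram_apply_zero_zero (σ : K →+* K) (D : Fin 3 → K) (x y z p r : K) :
    (((Matrix.of ![![1, 0, 0], ![x, p, 0], ![y, z, r]]).map σ)ᵀ * Matrix.diagonal D * Matrix.of ![![1, 0, 0], ![x, p, 0], ![y, z, r]]) 0 0 =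
      D 0 + σ x * D 1 * x + σ y * D 2 * y := by
  simp [Matrix.mul_apply, Fin.sum_univ_three]

omit [Valued K ℤᵐ⁰] in
/-- The determinant of `(σV)ᵀ·diag(D)·V`: `σ(p r)·(D₀D₁D₂)·(p r)`. [cite: Jacobowitz1962, §4] -/
theorem hnf_gram_det (σ : K →+* K) (D : Fin 3 → K) (x y z p r : K) :
    (((Matrix.of ![![1, 0, 0], ![x, p, 0], ![y, z, r]]).map σ)ᵀ * Matrix.diagonal D * Matrix.of ![![1, 0, 0], ![x, p, 0], ![y, z, r]]).det =
      σ (p * r) * (D 0 * D 1 * D 2) * (p * r) := by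
  rw [Matrix.det_mul, Matrix.det_mul, Matrix.det_transpose, ← RingHom.mapMatrix_apply, ← RingHom.map_det, Matrix.det_diagonal, det_hnf,
    Fin.prod_univ_three]

/-! ## §3  The dual-frame values `|D_i|` and the Gram values, packaged -/

/-- **THE DUAL-FRAME VALUES `|D_i|` AT A NORMALISED HNF LATTICE** (★ (3c-i), unpacked): if `latt (1 0 0; x ϖ^b 0; y z ϖ^c)` (`x y z ∈ 𝒪`, normalised) is a type-`0` vertex lattice of
`diag(D)` (`D_i ≠ 0`, `σ` valuation-preserving, `|ϖ| = exp(−1)`), then `|D₂| = exp c`; `exp b ≤ |D₁|`, `|z|·exp(b+c) ≤ |D₁|`, one of them an equality; `1 ≤ |D₀|`, `|x|·exp b ≤ |D₀|`,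
`|xz − yϖ^b|·exp(b+c) ≤ |D₀|`, one of them an equality — i.e. `|D₁| = max(exp b, |z| exp(b+c))`, `|D₀| = max(1, |x| exp b, |xz − yϖ^b| exp(b+c))` (MEMO v2 §1 axis exponents).
[cite: Jacobowitz1962, §4, §7] [cite: Serre1980Trees, II §1.1] -/
theorem dualFrame_values {σ : K →+* K} (hvσ : ∀ a, Valued.v (σ a) = Valued.v a) {ϖ : K} (hϖ : Valued.v ϖ = WithZero.exp (-1 : ℤ))
    {D : Fin 3 → K} (hD0 : ∀ i, D i ≠ 0) (b c : ℕ) {x y z : K} (hx : Valued.v x ≤ 1) (hy : Valued.v y ≤ 1) (hz : Valued.v z ≤ 1)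
    (hn : IsNormalisedLattice (latt (Matrix.of ![![1, 0, 0], ![x, ϖ ^ b, 0], ![y, z, ϖ ^ c]])))
    (hM : IsVertexLattice σ ϖ (Matrix.diagonal D) 0 (latt (Matrix.of ![![1, 0, 0], ![x, ϖ ^ b, 0], ![y, z, ϖ ^ c]]))) :
    Valued.v (D 2) = WithZero.exp (c : ℤ) ∧
    (WithZero.exp (b : ℤ) ≤ Valued.v (D 1) ∧ Valued.v z * WithZero.exp ((b : ℤ) + c) ≤ Valued.v (D 1) ∧
      (Valued.v (D 1) = WithZero.exp (b : ℤ) ∨ Valued.v (D 1) = Valued.v z * WithZero.exp ((b : ℤ) + c))) ∧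
    ((1 : ℤᵐ⁰) ≤ Valued.v (D 0) ∧ Valued.v x * WithZero.exp (b : ℤ) ≤ Valued.v (D 0) ∧
      Valued.v (x * z - y * ϖ ^ b) * WithZero.exp ((b : ℤ) + c) ≤ Valued.v (D 0) ∧
      (Valued.v (D 0) = 1 ∨ Valued.v (D 0) = Valued.v x * WithZero.exp (b : ℤ) ∨
        Valued.v (D 0) = Valued.v (x * z - y * ϖ ^ b) * WithZero.exp ((b : ℤ) + c))) := by
  have hvD0 : ∀ i, Valued.v (D i) ≠ 0 := fun i => (Valuation.ne_zero_iff _).2 (hD0 i)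
  have hϖ0 : ϖ ≠ 0 := (Valuation.ne_zero_iff Valued.v).1 (by rw [hϖ]; exact WithZero.exp_ne_zero)
  have hq : ∀ n : ℕ, Valued.v (ϖ ^ n) = WithZero.exp (-(n : ℤ)) := fun n => by
    rw [map_pow, hϖ, ← WithZero.exp_nsmul]
    congr 1
    simp
  have hqσ : ∀ n : ℕ, Valued.v (σ ϖ ^ n) = WithZero.exp (-(n : ℤ)) := fun n => by
    rw [map_pow, hvσ, ← map_pow, hq]
  have hq1 : ∀ n : ℕ, Valued.v (ϖ ^ n) ≤ 1 := fun n => by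
    rw [hq, ← WithZero.exp_zero, WithZero.exp_le_exp]; omega
  have hq1' : ∀ n : ℕ, Valued.v ϖ ^ n ≤ 1 := fun n => by rw [← map_pow]; exact hq1 n
  -- normalisation, unfolded on the HNF coordinates; the three row maxima of `V` are `1`
  have hN := (normalised_latt_hnf_iff hx hy hz (hq1 b) (hq1 c)).1 hn
  have hR : ∀ i : Fin 3, Finset.univ.sup' Finset.univ_nonempty
      (fun j => Valued.v ((!![1, 0, 0; x, ϖ ^ b, 0; y, z, ϖ ^ c] : Matrix (Fin 3) (Fin 3) K) i j)) = 1 := by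
    intro i
    apply sup'_univ_eq_of_forall_le_of_exists_eq
    · intro j
      fin_cases i <;> fin_cases j <;> simp [hx, hy, hz, hq1']
    · fin_cases i
      · exact ⟨0, by simp⟩
      · rcases hN.1 with h | h
        · exact ⟨1, by simpa using h⟩
        · exact ⟨0, by simpa using h⟩
      · rcases hN.2 with h | h | h
        · exact ⟨2, by simpa using h⟩
        · exact ⟨0, by simpa using h⟩
        · exact ⟨1, by simpa using h⟩
  -- ★ (3c-i): `|D_i|` = the `i`-th row maximum of the dual frame `U_1`; valuations of its entries
  have hA := fun i => v_eq_rowSup_dualOne_of_rowSup_eq_one hvσ hϖ0 hD0 x y z b c hM i (hR i)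
  have vU11 : Valued.v ((σ ϖ ^ b)⁻¹) = WithZero.exp (b : ℤ) := by
    rw [map_inv₀, hqσ, ← WithZero.exp_neg, neg_neg]
  have vU22 : Valued.v ((σ ϖ ^ c)⁻¹) = WithZero.exp (c : ℤ) := by
    rw [map_inv₀, hqσ, ← WithZero.exp_neg, neg_neg]
  have vU12 : Valued.v (-σ z * (σ ϖ ^ b)⁻¹ * (σ ϖ ^ c)⁻¹) = Valued.v z * WithZero.exp ((b : ℤ) + c) := by
    rw [map_mul, map_mul, Valuation.map_neg, hvσ, vU11, vU22, WithZero.exp_add, mul_assoc]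
  have vU01 : Valued.v (-σ x * (σ ϖ ^ b)⁻¹) = Valued.v x * WithZero.exp (b : ℤ) := by
    rw [map_mul, Valuation.map_neg, hvσ, vU11]
  have vU02 : Valued.v ((σ x * σ z * (σ ϖ ^ b)⁻¹ - σ y) * (σ ϖ ^ c)⁻¹) = Valued.v (x * z - y * ϖ ^ b) * WithZero.exp ((b : ℤ) + c) := by
    have h1 : σ x * σ z * (σ ϖ ^ b)⁻¹ - σ y = σ ((x * z - y * ϖ ^ b) * (ϖ ^ b)⁻¹) := by
      rw [sub_mul, mul_inv_cancel_right₀ (pow_ne_zero _ hϖ0), map_sub, map_mul, map_mul, map_inv₀, map_pow]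
    rw [map_mul, h1, hvσ, map_mul, map_inv₀, hq, ← WithZero.exp_neg, neg_neg, vU22, mul_assoc, ← WithZero.exp_add]
  refine ⟨?_, ⟨?_, ?_, ?_⟩, ⟨?_, ?_, ?_, ?_⟩⟩
  · obtain ⟨j, hj⟩ := exists_eq_of_sup'_univ_eq (hA 2).symm
    fin_cases j
    · exact absurd (by simpa using hj) (hvD0 2).symm
    · exact absurd (by simpa using hj) (hvD0 2).symm
    · rw [← hj]
      change Valued.v ((σ ϖ ^ c)⁻¹) = _
      exact vU22
  · have := le_of_sup'_univ_eq (hA 1).symm 1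
    change Valued.v ((σ ϖ ^ b)⁻¹) ≤ _ at this
    rwa [vU11] at this
  · have := le_of_sup'_univ_eq (hA 1).symm 2
    change Valued.v (-σ z * (σ ϖ ^ b)⁻¹ * (σ ϖ ^ c)⁻¹) ≤ _ at this
    rwa [vU12] at this
  · obtain ⟨j, hj⟩ := exists_eq_of_sup'_univ_eq (hA 1).symm
    fin_cases j
    · exact absurd (by simpa using hj) (hvD0 1).symm
    · left
      rw [← hj]
      change Valued.v ((σ ϖ ^ b)⁻¹) = _
      exact vU11
    · right
      rw [← hj]
      change Valued.v (-σ z * (σ ϖ ^ b)⁻¹ * (σ ϖ ^ c)⁻¹) = _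
      exact vU12
  · have := le_of_sup'_univ_eq (hA 0).symm 0
    change Valued.v (1 : K) ≤ _ at this
    rwa [map_one] at this
  · have := le_of_sup'_univ_eq (hA 0).symm 1
    change Valued.v (-σ x * (σ ϖ ^ b)⁻¹) ≤ _ at this
    rwa [vU01] at this
  · have := le_of_sup'_univ_eq (hA 0).symm 2
    change Valued.v ((σ x * σ z * (σ ϖ ^ b)⁻¹ - σ y) * (σ ϖ ^ c)⁻¹) ≤ _ at this
    rwa [vU02] at this
  · obtain ⟨j, hj⟩ := exists_eq_of_sup'_univ_eq (hA 0).symm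
    fin_cases j
    · left
      rw [← hj]
      change Valued.v (1 : K) = _
      exact map_one _
    · right; left
      rw [← hj]
      change Valued.v (-σ x * (σ ϖ ^ b)⁻¹) = _
      exact vU01
    · right; right
      rw [← hj]
      change Valued.v ((σ x * σ z * (σ ϖ ^ b)⁻¹ - σ y) * (σ ϖ ^ c)⁻¹) = _
      exact vU02

/-- **THE GRAM VALUES IN THE HNF BASIS**: for a type-`0` vertex lattice `latt V` of `diag(D)` (`V = (1 0 0; x ϖ^b 0; y z ϖ^c)`, `ϖ ≠ 0`, `σ` valuation-preserving), the Gram matrix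
`(σV)ᵀ diag(D) V` of THIS basis is integral with `|det| = 1` (★ `vertexTriple_of_latt_eq`); in particular `|σ(ϖ^b)D₁ϖ^b + σz·D₂·z| ≤ 1`, `|D₀ + σx·D₁·x + σy·D₂·y| ≤ 1` and
`|σ(ϖ^bϖ^c)·(D₀D₁D₂)·(ϖ^bϖ^c)| = 1`. [cite: Jacobowitz1962, §4, §7] -/
theorem gram_values {σ : K →+* K} (hvσ : ∀ a, Valued.v (σ a) = Valued.v a) {ϖ : K} (hϖ0 : ϖ ≠ 0) (D : Fin 3 → K) (b c : ℕ) (x y z : K)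
    (hM : IsVertexLattice σ ϖ (Matrix.diagonal D) 0 (latt (Matrix.of ![![1, 0, 0], ![x, ϖ ^ b, 0], ![y, z, ϖ ^ c]]))) :
    Valued.v (σ (ϖ ^ b) * D 1 * ϖ ^ b + σ z * D 2 * z) ≤ 1 ∧ Valued.v (D 0 + σ x * D 1 * x + σ y * D 2 * y) ≤ 1 ∧
      Valued.v (σ (ϖ ^ b * ϖ ^ c) * (D 0 * D 1 * D 2) * (ϖ ^ b * ϖ ^ c)) = 1 := by
  have hdetV : (Matrix.of ![![1, 0, 0], ![x, ϖ ^ b, 0], ![y, z, ϖ ^ c]] : Matrix (Fin 3) (Fin 3) K).det ≠ 0 := by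
    rw [det_hnf]; exact mul_ne_zero (pow_ne_zero _ hϖ0) (pow_ne_zero _ hϖ0)
  obtain ⟨hint, -, hdetG⟩ := vertexTriple_of_latt_eq hvσ (g' := Matrix.GeneralLinearGroup.mkOfDetNeZero _ hdetV) hM
  refine ⟨?_, ?_, ?_⟩
  · have h := hint 1 1
    rwa [show formCongr σ (Matrix.GeneralLinearGroup.mkOfDetNeZero _ hdetV) (Matrix.diagonal D) 1 1 = _ from
      hnf_gram_apply_one_one σ D x y z (ϖ ^ b) (ϖ ^ c)] at h
  · have h := hint 0 0
    rwa [show formCongr σ (Matrix.GeneralLinearGroup.mkOfDetNeZero _ hdetV) (Matrix.diagonal D) 0 0 = _ from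
      hnf_gram_apply_zero_zero σ D x y z (ϖ ^ b) (ϖ ^ c)] at h
  · rwa [show (formCongr σ (Matrix.GeneralLinearGroup.mkOfDetNeZero _ hdetV) (Matrix.diagonal D)).det = _ from
      hnf_gram_det σ D x y z (ϖ ^ b) (ϖ ^ c), pow_zero] at hdetG

end Summit.HodgeConjecture.HodgeConjecture.Cruxes.H413.F0P3cDyRamDiagonalHNFDualFrameValues

end
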